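import Summits.CriticalPhenomena.PercolationContinuityZ3.Theorems.PercNearOneGluingNoHeavyQuantGatedSliceMixLawBTwinSharp
import Summits.CriticalPhenomena.PercolationContinuityZ3.Theorems.PercNearOneGluingNoHeavyQuantGatedSliceMixLawBTwinIneq
import Summits.CriticalPhenomena.PercolationContinuityZ3.Theorems.PercNearOneGluingNoHeavyQuantGatedSliceMixLawRegimeBCellBM
import HarnessLib

/-!
# QUANT lane R8, T-DEC, leg (III), blob case — `LawDec.GatedSliceMixLaw'` in REGIME B: CELL B-TWIN IS A THEOREM
# (`mixLawCellBTwin_holds : MixLawCellBTwin`)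

builds on p205010 (kernel theorem, internal audit signed; external expert review pending)

Support file (`--supports stmt-CriticalPhenomena-4575`), QUANT lane seat prim-quant-arm-3 (gen 120), rung R8 of
`run/shared/lean/prim/quant/LADDER.md`; lead g33's ask (lane INBOX l.1163 / HANDOFF GEN-33 TRUE CLOSING: "(PI) for BTwin", one of the
three remaining leaves of the node `GatedSliceMixLaw'`).  Theorems only, standard axioms, no sorries, no definitions.  Closes the
`@[conjecture] def LawDec.MixLawCellBTwin` of `…QuantGatedSliceMixLawRegimeBCells` (census-2 g61) — the `hBTwin` antecedent of census-2's
regime-B assembly.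

THE CELL (frame of `GatedSliceMixLaw'`: `t = S + ag(1−z)`, `u = y/(1−y)`, `P = z·δ₀ + m₁δ_{k₁} + m₁'δ_ℓ + m₂δ_{k₂} + m₂'δ_{k₂+a}`,
`m₁ = (1−z)(1−λ)(1−g)`, `m₁' = (1−z)(1−λ)g`, `m₂ + m₂' = (1−z)λ`, `W_h = w₀δ₀ + w_hδ_h + W_Gδ_{h+a}`): regime B, `k₁` a `t`-low, its twin
`ℓ = k₁ + a ≤ j` a mid (`t ≤ 2ℓ`), the top `k₂ ≥ j+1` a giant, `W_h ∉ D`.  CLAIM: `θ·W_h + (1−θ)·P` is DEC at `(y, t, j)` for some `θ < 1`.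

THE PROOF (this seat; arm-2 g36's exchange architecture `…QuantGatedSliceMixLawRegimeBTwin` + the sharp certificate `…BTwinSharp` +
the real-algebra core `…BTwinIneq`).  `k₁` fills its twin when compatible; if the twin holds all of `k₁` we are done
(`gatedSliceMixLaw_BTwin_fit`).  Otherwise (`btwin_overflow`) the twin is INCOMPATIBLE (`p := t − 2k₁ ≥ a`, overflow `o = m₁`,
`ω := o/((1−z)(1−λ)) = 1 − g`) or SATURATED (then the pair `(k₁,ℓ)` is dear, `usage(k₁,ℓ) = p/(a−p)`, `x_P = m₁'(a−p)/p`,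
`ω = 1 − ag/p ≤ 1 − g`).  Two routings for the overflow:
* (B1) `u(z + o) ≤ (1−z)λ`: everything to the giants, `θ = 0` (`gatedSliceMixLaw_BTwin_exchange` with `x_H = 0`).
* (B2) otherwise ALL of `o` into `W_h`'s mid `h`, priced exactly: `usage(k₁,h)·o·(u(h−S) − Sg) ≤ S(1−g)((1−z)λ − uz)`
  (`gatedSliceMixLaw_BTwin_exchange_sharp` with `x_G = 0`).  Proof of (B2) when (B1) fails: by `btwin_rate_pool` (at the giant rate)
  `ωS > S − k₁`, so (`btwin_delta_of_incomp/_of_sat`) the blob mean is below the low, `ag(1−z) < k₁`, i.e. `p < S − k₁`: the low is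
  compatible with `h` (`h > S`) and LIGHT at the virtual height `h* = S/y ≥ M ≥ h`; at `h*` the exchange inequality is the rate
  condition `btwin_core_light` fed into `btwin_rate_pool` (`btwin_virtual`), and both pieces of the gate `max(ρ, y² + (1−y)ρ)`,
  `ρ = p/(h−k₁)`, times `(o·u·(h−k₁) − B)` are nondecreasing in `h − k₁ ≤ N/y` because `B ≥ 0` (`btwin_B_nonneg`, from the failure of
  (B1)) — `btwin_gate_transfer`.  `W_h ∉ D` is used only to get `g < 1`.
WHY NOT (PI): arm-2 g36's pooled inequality bounds the price `u·w₀ − W_G` of `W_h`'s zero by `w_h`; it is FALSE as a pure inequality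
without `W_h ∉ D` (e.g. `y = 8/33, z = 0, g = 26/75, λ = 1/6, a = 1, k₁ = 1, k₂ = M = 11, h = j = 3`) and within 0.24 % of equality with it
(seat census, memo `run/shared/lean/prim/quant/prim-quant-arm-3-g120/BTWIN-ARM3-G120.md`); (B1) ∨ (B2) is exact criterion E.

* `LawDec.btwin_overflow` — the overflow data (`x_P`, `ω`) with `ωS > S − k₁ ⟹ ag(1−z) < k₁` and `S > 2k₁`.
* `LawDec.btwin_virtual` — the two gate pieces at the virtual height are within budget.
* `LawDec.btwin_gate_transfer` — transfer down to the actual mid: `pairGate(k₁,h)·(o·u·(h−k₁) − B) ≤ R`.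
* **`LawDec.mixLawCellBTwin_holds : MixLawCellBTwin`**; `LawDec.mixLawRegimeB_of_topBelow : MixLawCellBTopBelow → MixLawRegimeB`
  (census-2's `mixLawRegimeB_of_leaves` with the twin leaf discharged).
HONEST STATUS: cell B-TWIN of regime B is KERNEL and `MixLawRegimeB ⟸ MixLawCellBTopBelow`; node `GatedSliceMixLaw'` leaves left
(lead g33's map): `qk_Ib_lh` (QK, arm-1), `MixLawCellBTopBelow` (census-2); `MixLawRegimeB`, `GatedSliceMixLaw'`, CW, `SingleGateConvClosed`, `TreeDEC`, `FarTreeRow` OPEN; RATE class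
log* / honest sentence unchanged.

[this work]; exchange architecture prim-quant-arm-2 g36, cell map lead g32 / census-2 g61, flow normal form prim-quant-stmt g22–g30
(this lane).  Nothing here is cited as a published result.  The gluing rows served [cite: KozmaNitzan2024, Conjecture 3 (p. 15)];
product measure [cite: Grimmett1999, §1.3 p. 10].
-/

noncomputable section

namespace Summit.CriticalPhenomena.PercolationContinuityZ3.Theorems

namespace Quant

open Finset

/-- the two-point law `{lo, hi; g}` (as in `…QuantLawDEC`) -/
local notation3 "TP[" lo ", " hi ", " g ", " h "]" =>
  (g : ℝ) * (if (h : ℕ) = (hi : ℕ) then (1 : ℝ) else 0) + (1 - (g : ℝ)) * (if (h : ℕ) = (lo : ℕ) then (1 : ℝ) else 0)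

namespace LawDec

/-! ### The overflow of the twin -/

set_option maxHeartbeats 800000 in
/-- **THE OVERFLOW DATA OF CELL B-TWIN.**  If the twin does not hold all of `k₁` (it is incompatible, or compatible and saturated), there
are a twin amount `x_P ≥ 0` within capacity and a normalised overflow `ω ∈ [0, 1−g]` with `m₁ − x_P = (1−z)(1−λ)ω`
(`ω = 1−g`, resp. `ω = 1 − ag/p`), such that `ωS > S − k₁` forces the blob mean below the low (`ag(1−z) < k₁`), and `S > 2k₁`. [this work] -/
theorem btwin_overflow (y z g S lam t : ℝ) (a j k₁ : ℕ) (hy0 : 0 < y) (hy1 : y < 1) (hz0 : 0 ≤ z) (hz1 : z < 1)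
    (hg0 : 0 < g) (hg1 : g < 1) (hyg : y ≤ g) (hlam1 : lam ≤ 1) (ha1 : 1 ≤ a) (hS0 : 0 < S)
    (ht : t = S + (a : ℝ) * g * (1 - z)) (hk₁low : 2 * (k₁ : ℝ) < t) (hPj : k₁ + a ≤ j)
    (hFIT : ¬ (t < (k₁ : ℝ) + ((k₁ + a : ℕ) : ℝ) ∧
      usage y t j k₁ (k₁ + a) * ((1 - z) * (1 - lam) * (1 - g)) ≤ (1 - z) * (1 - lam) * g)) :
    ∃ xP ω : ℝ, 0 ≤ xP ∧ usage y t j k₁ (k₁ + a) * xP ≤ (1 - z) * (1 - lam) * g ∧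
      (0 < xP → t < (k₁ : ℝ) + ((k₁ + a : ℕ) : ℝ)) ∧
      (1 - z) * (1 - lam) * (1 - g) - xP = (1 - z) * (1 - lam) * ω ∧ 0 ≤ ω ∧ ω ≤ 1 - g ∧
      (S - k₁ < ω * S → (a : ℝ) * g * (1 - z) < k₁) ∧ 2 * (k₁ : ℝ) < S := by
  have h1y : 0 < 1 - y := by linarith
  have h1z : 0 < 1 - z := by linarith
  have h1g : 0 < 1 - g := by linarith
  have hzl : 0 ≤ (1 - z) * (1 - lam) := mul_nonneg h1z.le (by linarith)
  set m₁ : ℝ := (1 - z) * (1 - lam) * (1 - g) with hm₁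
  set m₁' : ℝ := (1 - z) * (1 - lam) * g with hm₁'
  have hm₁0 : 0 ≤ m₁ := mul_nonneg hzl h1g.le
  have hm₁'0 : 0 ≤ m₁' := mul_nonneg hzl hg0.le
  have hk₁0 : (0 : ℝ) ≤ k₁ := Nat.cast_nonneg _
  have ha0 : (1 : ℝ) ≤ a := by exact_mod_cast ha1
  have hp0 : 0 < t - 2 * (k₁ : ℝ) := by linarith
  have hcast : ((k₁ + a : ℕ) : ℝ) = (k₁ : ℝ) + a := by push_cast; ring
  by_cases hcP : t < (k₁ : ℝ) + ((k₁ + a : ℕ) : ℝ)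
  · -- SATURATED twin: compatible, but `usage(k₁,ℓ)·m₁ > m₁'`
    have hsat : ¬ usage y t j k₁ (k₁ + a) * m₁ ≤ m₁' := fun hf => hFIT ⟨hcP, hf⟩
    have hpa : t - 2 * (k₁ : ℝ) < a := by rw [hcast] at hcP; linarith
    -- the pair `(k₁, ℓ)` is dear (a light pair costs at most `u`, and `u·m₁ ≤ m₁'` by `y ≤ g`)
    have hdear : y * (((k₁ + a : ℕ) : ℝ) - k₁) ≤ t - 2 * (k₁ : ℝ) := by
      by_contra hlt
      have hlight : t - 2 * (k₁ : ℝ) ≤ y * (((k₁ + a : ℕ) : ℝ) - k₁) := le_of_lt (not_le.1 hlt)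
      have hU := usage_le_giant_of_light y t j k₁ (k₁ + a) hy0 hy1 hPj hk₁low hcP hlight
      apply hsat
      calc usage y t j k₁ (k₁ + a) * m₁ ≤ y / (1 - y) * m₁ := mul_le_mul_of_nonneg_right hU hm₁0
        _ ≤ m₁' := by
          rw [hm₁, hm₁', div_mul_eq_mul_div, div_le_iff₀ h1y]
          have h1 : y * (1 - g) ≤ g * (1 - y) := by nlinarith
          have h2 := mul_le_mul_of_nonneg_left h1 hzl
          linarith
    have hUP : usage y t j k₁ (k₁ + a) = (t - 2 * (k₁ : ℝ)) / ((k₁ : ℝ) + ((k₁ + a : ℕ) : ℝ) - t) :=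
      usage_eq_heavy' y t j k₁ (k₁ + a) hy0 hy1 hPj hk₁low hcP hdear
    have hden : (k₁ : ℝ) + ((k₁ + a : ℕ) : ℝ) - t = (a : ℝ) - (t - 2 * k₁) := by rw [hcast]; ring
    rw [hden] at hUP
    have hap : 0 < (a : ℝ) - (t - 2 * k₁) := by linarith
    -- saturation ⟹ `a g < p`
    have hagp : (a : ℝ) * g < t - 2 * k₁ := by
      by_contra hle
      apply hsat
      rw [hUP, hm₁, hm₁', div_mul_eq_mul_div, div_le_iff₀ hap]
      have h1 : (t - 2 * (k₁ : ℝ)) * (1 - g) ≤ g * ((a : ℝ) - (t - 2 * k₁)) := by nlinarith [not_lt.1 hle]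
      have h2 := mul_le_mul_of_nonneg_left h1 hzl
      linarith
    refine ⟨m₁' * ((a : ℝ) - (t - 2 * k₁)) / (t - 2 * k₁), (t - 2 * (k₁ : ℝ) - a * g) / (t - 2 * k₁),
      div_nonneg (mul_nonneg hm₁'0 hap.le) hp0.le, ?_, fun _ => hcP, ?_, ?_, ?_, ?_, ?_⟩
    · rw [hUP]
      have : (t - 2 * (k₁ : ℝ)) / ((a : ℝ) - (t - 2 * k₁)) * (m₁' * ((a : ℝ) - (t - 2 * k₁)) / (t - 2 * k₁)) = m₁' := by
        field_simp
      rw [this]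
    · rw [hm₁, hm₁']
      field_simp
      ring
    · exact div_nonneg (by linarith) hp0.le
    · rw [div_le_iff₀ hp0]; nlinarith
    · intro hωS
      -- ωS > S − k₁  ⟺  a g S < k₁ p
      have e1 : (t - 2 * (k₁ : ℝ) - a * g) / (t - 2 * k₁) * S = ((t - 2 * (k₁ : ℝ) - a * g) * S) / (t - 2 * k₁) := by ring
      rw [e1, lt_div_iff₀ hp0] at hωS
      have e2 : t - 2 * (k₁ : ℝ) = S - 2 * k₁ + a * g * (1 - z) := by rw [ht]; ring
      have hf : (a : ℝ) * g * S < k₁ * (S - 2 * k₁ + a * g * (1 - z)) := by rw [← e2]; linarith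
      have hS2 : 2 * (k₁ : ℝ) ≤ S := by
        have : (a : ℝ) * g * (1 - z) ≤ a * g := by nlinarith [mul_nonneg (mul_nonneg (le_trans zero_le_one ha0) hg0.le) hz0]
        linarith
      exact btwin_delta_of_sat z g S a k₁ hz0 hz1 hS0 hk₁0 hS2 hf
    · -- p > a g ≥ a g (1−z)  ⟹  S > 2k₁
      have : (a : ℝ) * g * (1 - z) ≤ a * g := by nlinarith [mul_nonneg (mul_nonneg (le_trans zero_le_one ha0) hg0.le) hz0]
      rw [ht] at hagp; linarith
  · -- INCOMPATIBLE twin: `t ≥ 2k₁ + a`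
    have hinc' : (k₁ : ℝ) + ((k₁ + a : ℕ) : ℝ) ≤ t := not_lt.1 hcP
    rw [hcast, ht] at hinc'
    refine ⟨0, 1 - g, le_rfl, by rw [mul_zero]; exact hm₁'0, fun h0 => absurd h0 (lt_irrefl 0), by rw [hm₁]; ring,
      h1g.le, le_rfl, ?_, ?_⟩
    · intro hωS
      have hf : g * S < k₁ := by linarith
      have hinc : (a : ℝ) * (1 - g * (1 - z)) ≤ S - 2 * k₁ := by linarith
      exact btwin_delta_of_incomp z g S a k₁ hz0 hz1 hg0.le hg1 hS0.le hinc hf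
    · -- S − 2k₁ ≥ a(1 − g(1−z)) > 0
      have hgc : g * (1 - z) < 1 := by nlinarith
      have := mul_pos (lt_of_lt_of_le zero_lt_one ha0) (sub_pos.2 hgc)
      linarith

/-! ### The exchange inequality at the virtual height `S/y`, and its transfer down to the actual mid -/

set_option maxHeartbeats 800000 in
/-- **AT THE VIRTUAL HEIGHT.**  With `u = y/(1−y)`, `N = S − y k₁`, `R = S(1−g)((1−z)λ − uz)`, `B = o(u(S−k₁) + Sg) − R` and the
exchange inequality in rate form `y(yN + (1−y)p)·o ≤ (1−y)((1+y)N − yp)((1−z)λ − uz)`: the light and the heavy pieces of the gate at the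
virtual height are within budget, `y·o·u·N − y²B + (1−y)(p·o·u − p·B·y/N) ≤ R` and `p·o·u − p·B·y/N ≤ R` (`0 ≤ p < N`). [this work] -/
theorem btwin_virtual (y z g S lam k₁ p o u N R B : ℝ) (hy0 : 0 < y) (hy1 : y < 1) (hg1 : g ≤ 1) (hS0 : 0 ≤ S)
    (ho0 : 0 ≤ o) (hN0 : 0 < N) (hNp : p < N) (hR0 : 0 ≤ R)
    (hu : u = y / (1 - y)) (hN : N = S - y * k₁) (hR : R = S * (1 - g) * ((1 - z) * lam - u * z))
    (hB : B = o * (u * (S - k₁) + S * g) - R)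
    (hstar : y * (y * N + (1 - y) * p) * o ≤ (1 - y) * ((1 + y) * N - y * p) * ((1 - z) * lam - u * z)) :
    y * o * u * N - y ^ 2 * B + (1 - y) * (p * o * u - p * B * y / N) ≤ R ∧ p * o * u - p * B * y / N ≤ R := by
  have h1y : 0 < 1 - y := by linarith
  have h1g : 0 ≤ 1 - g := by linarith
  have hNne : N ≠ 0 := hN0.ne'
  have hNne' : S - y * k₁ ≠ 0 := by rw [← hN]; exact hNne
  have h1yne : 1 - y ≠ 0 := h1y.ne'
  have hdag : y * o * u * N - y ^ 2 * B + (1 - y) * (p * o * u - p * B * y / N) ≤ R := by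
    have e : y * o * u * N - y ^ 2 * B + (1 - y) * (p * o * u - p * B * y / N) - R
        = S * (1 - g) / N * (y * (y * N + (1 - y) * p) * o - (1 - y) * ((1 + y) * N - y * p) * ((1 - z) * lam - u * z)) := by
      rw [hB, hR, hN, hu]
      field_simp
      ring
    have : S * (1 - g) / N * (y * (y * N + (1 - y) * p) * o - (1 - y) * ((1 + y) * N - y * p) * ((1 - z) * lam - u * z)) ≤ 0 :=
      mul_nonpos_of_nonneg_of_nonpos (div_nonneg (mul_nonneg hS0 h1g) hN0.le) (by linarith)
    linarith
  refine ⟨hdag, ?_⟩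
  -- `o u N − y B = (1−y)(o S (1−g) + R) ≥ 0`, and `N − p > 0`
  have hW0 : y * B ≤ o * u * N := by
    have e : o * u * N - y * B = y * (o * S * (1 - g) + R) := by
      rw [hB, hR, hN, hu]
      field_simp
      ring
    have := mul_nonneg hy0.le (add_nonneg (mul_nonneg (mul_nonneg ho0 hS0) h1g) hR0)
    linarith
  have e : y * o * u * N - y ^ 2 * B - y * (p * o * u - p * B * y / N) = y * (N - p) / N * (o * u * N - y * B) := by
    field_simp
  have hnn : 0 ≤ y * (N - p) / N * (o * u * N - y * B) :=
    mul_nonneg (div_nonneg (mul_nonneg hy0.le (by linarith)) hN0.le) (by linarith)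
  have hyQ : y * (p * o * u - p * B * y / N) + (1 - y) * (p * o * u - p * B * y / N) ≤ R := by linarith
  linarith

set_option maxHeartbeats 800000 in
/-- **TRANSFER TO THE ACTUAL MID.**  For a `t`-low `k₁` compatible with the mid `h` (`2k₁ < t < k₁ + h`), `y(h − k₁) ≤ N`, `B ≥ 0`,
`o·u ≥ 0`, `R ≥ 0` and the two virtual bounds of `btwin_virtual` (`p = t − 2k₁`): `pairGate y t k₁ h · (o·u·(h − k₁) − B) ≤ R`
(both pieces of the gate are nondecreasing in `h − k₁ ≤ N/y`). [this work] -/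
theorem btwin_gate_transfer (y t N o u B R : ℝ) (k₁ h : ℕ) (hy0 : 0 < y) (hy1 : y < 1) (hlow : 2 * (k₁ : ℝ) < t)
    (hcomp : t < (k₁ : ℝ) + h) (hou : 0 ≤ o * u) (hB0 : 0 ≤ B) (hR0 : 0 ≤ R) (hN0 : 0 < N) (hηN : y * ((h : ℝ) - k₁) ≤ N)
    (hdag : y * o * u * N - y ^ 2 * B + (1 - y) * ((t - 2 * (k₁ : ℝ)) * o * u - (t - 2 * (k₁ : ℝ)) * B * y / N) ≤ R)
    (hddag : (t - 2 * (k₁ : ℝ)) * o * u - (t - 2 * (k₁ : ℝ)) * B * y / N ≤ R) :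
    pairGate y t k₁ h * (o * u * ((h : ℝ) - k₁) - B) ≤ R := by
  have h1y : 0 < 1 - y := by linarith
  set p : ℝ := t - 2 * (k₁ : ℝ) with hp
  have hp0 : 0 < p := by rw [hp]; linarith
  have hη0 : 0 < (h : ℝ) - k₁ := by linarith
  have hγ0 : 0 < pairGate y t k₁ h := by
    refine pairGate_pos y t k₁ h hlow ?_
    have : (k₁ : ℝ) < h := by linarith
    exact_mod_cast this
  set V : ℝ := o * u * ((h : ℝ) - k₁) - B with hV
  -- 1/(h − k₁) ≥ y/N
  have hrec : p * B * y / N ≤ p * B / ((h : ℝ) - k₁) := by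
    rw [div_le_div_iff₀ hN0 hη0]
    have := mul_le_mul_of_nonneg_left hηN (mul_nonneg hp0.le hB0)
    linarith
  have hpiece1 : p / ((h : ℝ) - k₁) * V ≤ R := by
    have e : p / ((h : ℝ) - k₁) * V = p * o * u - p * B / ((h : ℝ) - k₁) := by
      rw [hV]; field_simp
    rw [e]; linarith
  have hpiece2 : (y ^ 2 + (1 - y) * (p / ((h : ℝ) - k₁))) * V ≤ R := by
    have e : (y ^ 2 + (1 - y) * (p / ((h : ℝ) - k₁))) * V
        = y ^ 2 * (o * u * ((h : ℝ) - k₁)) - y ^ 2 * B + (1 - y) * (p * o * u - p * B / ((h : ℝ) - k₁)) := by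
      rw [hV]; field_simp
    rw [e]
    have h1 : y ^ 2 * (o * u * ((h : ℝ) - k₁)) ≤ y * o * u * N := by
      have := mul_le_mul_of_nonneg_left hηN (mul_nonneg hy0.le hou)
      nlinarith
    have h2 : (1 - y) * (p * o * u - p * B / ((h : ℝ) - k₁)) ≤ (1 - y) * (p * o * u - p * B * y / N) :=
      mul_le_mul_of_nonneg_left (by linarith) h1y.le
    linarith
  rcases le_or_gt V 0 with hV0 | hVpos
  · exact le_trans (mul_nonpos_of_nonneg_of_nonpos hγ0.le hV0) hR0
  · have e : pairGate y t k₁ h = max (p / ((h : ℝ) - k₁)) (y ^ 2 + (1 - y) * (p / ((h : ℝ) - k₁))) := by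
      simp only [pairGate, hp]
    rw [e, max_mul_of_nonneg _ _ hVpos.le]
    exact max_le hpiece1 hpiece2

/-! ### Cell B-TWIN is a theorem -/

set_option maxHeartbeats 1600000 in
/-- **`LawDec.MixLawCellBTwin` HOLDS.**  Frame of `MixLawRegimeB` with the twin `ℓ = k₁ + a` a mid and the top `k₂` a giant.  Routing:
`k₁` fills its twin (when compatible); if the twin holds everything, `gatedSliceMixLaw_BTwin_fit`; otherwise the overflow
`o = (1−z)(1−λ)ω` (`btwin_overflow`) goes EITHER to the giants (`θ = 0`, when `u(z + o) ≤ (1−z)λ`, `gatedSliceMixLaw_BTwin_exchange`)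
OR entirely to `W_h`'s mid `h` at the exact exchange price (`gatedSliceMixLaw_BTwin_exchange_sharp`).  In the second case
`ωS > S − k₁` (`btwin_rate_pool` at the giant rate), hence `p = t − 2k₁ < S − k₁` (blob mean below the low): `k₁` is compatible with `h`
and light at the virtual height `S/y ≥ h`, where the exchange inequality is `btwin_core_light` + `btwin_rate_pool` (`btwin_virtual`); it
transfers down to the actual `h` by `btwin_gate_transfer` (`B ≥ 0` by `btwin_B_nonneg`).  `W_h ∉ D` is used only for `g < 1`.
[this work] -/
theorem mixLawCellBTwin_holds : MixLawCellBTwin := by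
  intro y z g S lam a j M h k₁ k₂ hy0 hy1 hz0 hz1 hg1 hyg ha1 _hjM hS0 hta hhj hhM hSh hW hk hk₂M hlam0 hlam1 hmean
    hk₁j hk₁low hPj _hk₂aG htS hhaG hPmid hk₂G
  classical
  set t : ℝ := S + (a : ℝ) * g * (1 - z) with ht
  -- positivity and frame facts
  have h1y : 0 < 1 - y := by linarith
  have h1z : 0 < 1 - z := by linarith
  have hg0 : 0 < g := (mul_pos_iff_of_pos_left h1z).mp (lt_of_lt_of_le hy0 hyg)
  have hh0 : (0 : ℝ) < h := lt_trans hS0 hSh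
  have hyh : y * (h : ℝ) ≤ S := le_trans (mul_le_mul_of_nonneg_left (by exact_mod_cast hhM) hy0.le) hta
  have hhmid : t ≤ 2 * (h : ℝ) := by rw [ht]; linarith
  have hXw : ¬ (y / (1 - y) * (1 - S / h) ≤ S / h * g) := fun hcov =>
    hW (decAtT_weakMidLaw_of_giant y z g S a j M h hy0 hy1 hg0.le hg1 hS0.le hSh hhj hhM hhaG hhmid hcov)
  have hg1' : g < 1 := by
    by_contra hge
    have hgeq : g = 1 := le_antisymm hg1 (not_lt.1 hge)
    apply hXw
    rw [hgeq, mul_one, div_mul_eq_mul_div, div_le_iff₀ h1y]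
    have hys : y ≤ S / h := by rw [le_div_iff₀ hh0]; exact hyh
    nlinarith
  have h1g : 0 < 1 - g := by linarith
  have h1lam : 0 ≤ 1 - lam := by linarith
  have hzl : 0 ≤ (1 - z) * (1 - lam) := mul_nonneg h1z.le h1lam
  set u : ℝ := y / (1 - y) with hu
  have hu0 : 0 < u := div_pos hy0 h1y
  have hk12n : k₁ < k₂ := by omega
  have hk12 : (k₁ : ℝ) < k₂ := by exact_mod_cast hk12n
  have hyk₂ : y * (k₂ : ℝ) ≤ S := le_trans (mul_le_mul_of_nonneg_left (by exact_mod_cast hk₂M) hy0.le) hta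
  have hk₁0 : (0 : ℝ) ≤ k₁ := Nat.cast_nonneg _
  have hk₁S : (k₁ : ℝ) < S := by linarith
  have hzg : 0 ≤ z * g := mul_nonneg hz0 hg0.le
  have hyg' : y ≤ g := by linarith [hyg, (by ring : (1 - z) * g = g - z * g)]
  have hyz : y + z ≤ 1 := by
    have : (1 - z) * g ≤ (1 - z) * 1 := mul_le_mul_of_nonneg_left hg1 h1z.le
    linarith
  have hp0 : 0 < t - 2 * (k₁ : ℝ) := by linarith
  -- the giant budget dominates the zeros (`mixLawB_QG`)
  have hQG : u * z ≤ (1 - z) * lam := mixLawB_QG y z S lam k₁ k₂ hy0 hy1 hz0 hyz hk12 hk₁S.le hyk₂ hmean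
  -- Case FIT: the twin is compatible and holds all of `k₁`
  by_cases hFIT : t < (k₁ : ℝ) + ((k₁ + a : ℕ) : ℝ) ∧
      usage y t j k₁ (k₁ + a) * ((1 - z) * (1 - lam) * (1 - g)) ≤ (1 - z) * (1 - lam) * g
  · exact gatedSliceMixLaw_BTwin_fit y z g S lam a j M h k₁ k₂ hy0 hy1 hz0 hz1 hg0.le hg1' hyg hS0 hta hhj hhM hSh hk hk₂M
      hlam0 hlam1 hmean hk₁j hk₁low hPj hPmid hk₂G hhaG htS hFIT.1 hFIT.2
  -- Otherwise: the overflow data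
  obtain ⟨xP, ω, hxP0, hcapP, hPcomp, hoω, hω0, hω1, hωfail, hS2k⟩ :=
    btwin_overflow y z g S lam t a j k₁ hy0 hy1 hz0 hz1 hg0 hg1' hyg' hlam1 ha1 hS0 ht hk₁low hPj hFIT
  set o : ℝ := (1 - z) * (1 - lam) * (1 - g) - xP with ho
  have hoω' : o = (1 - z) * (1 - lam) * ω := hoω
  have ho0 : 0 ≤ o := by rw [hoω']; exact mul_nonneg hzl hω0
  ------------------------------------------------------------------
  -- Case θ = 0 suffices: the whole overflow rides the giants
  ------------------------------------------------------------------
  by_cases hB1 : u * (z + o) ≤ (1 - z) * lam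
  · exact gatedSliceMixLaw_BTwin_exchange y z g S lam a j M h k₁ k₂ xP 0 o hy0 hy1 hz0 hz1 hg0.le hg1' hS0 hta hhj hhM hSh
      hk hk₂M hlam0 hlam1 hk₁j hk₁low hPj hPmid hk₂G hhaG hhmid hxP0 le_rfl ho0 (by rw [ho]; ring) hPcomp
      (fun h0 => absurd h0 (lt_irrefl 0)) hcapP (by rw [mul_zero, zero_add]; linarith)
  ------------------------------------------------------------------
  -- Case exchange: the whole overflow rides `W_h`'s mid `h`
  ------------------------------------------------------------------
  have hfail : (1 - z) * lam < u * (z + o) := not_le.1 hB1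
  -- ωS > S − k₁ (else the giant rate passes `btwin_rate_pool`)
  have hωS : S - k₁ < ω * S := by
    by_contra hle
    apply hB1
    have hrate : u * ω * S * (1 - y) ≤ y * (S - k₁) := by
      have e : u * ω * S * (1 - y) = y * (ω * S) := by rw [hu]; field_simp
      rw [e]; exact mul_le_mul_of_nonneg_left (not_lt.1 hle) hy0.le
    have hA := btwin_rate_pool y z S lam k₁ k₂ u ω hy0 hy1 hz0 hyz hk₁0 hk12 hk₁S.le hS0 hyk₂ hlam1 hmean hrate
    rw [← hoω'] at hA
    linarith
  have hδ : (a : ℝ) * g * (1 - z) < k₁ := hωfail hωS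
  have hpS : t - 2 * (k₁ : ℝ) < S - k₁ := by rw [ht]; linarith
  have hHcomp : t < (k₁ : ℝ) + h := by linarith
  -- abbreviations
  set p : ℝ := t - 2 * (k₁ : ℝ) with hp
  set N : ℝ := S - y * k₁ with hN
  set R : ℝ := S * (1 - g) * ((1 - z) * lam - u * z) with hR
  set B : ℝ := o * (u * (S - k₁) + S * g) - R with hB
  have hR0 : 0 ≤ R := mul_nonneg (mul_nonneg hS0.le h1g.le) (by linarith)
  have hyk₁ : y * (k₁ : ℝ) ≤ k₁ := mul_le_of_le_one_left hk₁0 hy1.le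
  have hNp : p < N := by linarith
  have hN0 : 0 < N := by linarith
  have hB0 : 0 ≤ B := btwin_B_nonneg y z g S lam k₁ o hy0 hy1 hyg' hg1 hk₁S.le hk₁0 ho0 hfail
  -- the exchange inequality at the virtual height `S/y` from the core inequality and the rate lemma
  have hcore : (y * N + (1 - y) * p) * ω * S ≤ (S - k₁) * ((1 + y) * N - y * p) :=
    btwin_core_light y g S p k₁ ω hy0 hy1 hyg' hg1 hk₁0 hS2k.le hp0.le hpS.le hω1
  have hyNp : 0 ≤ y * (N - p) := mul_nonneg hy0.le (by linarith)
  have hDen : 0 < (1 - y) * ((1 + y) * N - y * p) := by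
    refine mul_pos h1y ?_
    linarith [(by ring : (1 + y) * N - y * p = N + y * (N - p))]
  have hstar : y * (y * N + (1 - y) * p) * o ≤ (1 - y) * ((1 + y) * N - y * p) * ((1 - z) * lam - u * z) := by
    have hrate : y * (y * N + (1 - y) * p) / ((1 - y) * ((1 + y) * N - y * p)) * ω * S * (1 - y) ≤ y * (S - k₁) := by
      rw [div_mul_eq_mul_div, div_mul_eq_mul_div, div_mul_eq_mul_div, div_le_iff₀ hDen]
      have := mul_le_mul_of_nonneg_left hcore (mul_nonneg hy0.le h1y.le)
      linarith
    have hA := btwin_rate_pool y z S lam k₁ k₂ _ ω hy0 hy1 hz0 hyz hk₁0 hk12 hk₁S.le hS0 hyk₂ hlam1 hmean hrate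
    rw [← hoω'] at hA
    have hA' : y * (y * N + (1 - y) * p) / ((1 - y) * ((1 + y) * N - y * p)) * o ≤ (1 - z) * lam - u * z := by linarith
    rw [div_mul_eq_mul_div, div_le_iff₀ hDen] at hA'
    linarith
  obtain ⟨hdag, hddag⟩ := btwin_virtual y z g S lam k₁ p o u N R B hy0 hy1 hg1 hS0.le ho0 hN0 hNp hR0 hu hN hR hB hstar
  ------------------------------------------------------------------
  -- transfer to the actual mid `h ≤ S/y`: `usage(k₁,h)·o·(u(h−S) − Sg) ≤ R`
  ------------------------------------------------------------------
  have hηN : y * ((h : ℝ) - k₁) ≤ N := by rw [hN]; linarith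
  have hgate : pairGate y t k₁ h * (o * u * ((h : ℝ) - k₁) - B) ≤ R :=
    btwin_gate_transfer y t N o u B R k₁ h hy0 hy1 hk₁low hHcomp (mul_nonneg ho0 hu0.le) hB0 hR0 hN0 hηN hdag hddag
  have hVid : o * u * ((h : ℝ) - k₁) - B = o * (u * ((h : ℝ) - S) - S * g) + R := by rw [hB]; ring
  rw [hVid] at hgate
  have hnj : ¬ (j + 1 ≤ h) := by omega
  have hγ1 : pairGate y t k₁ h < 1 := pairGate_lt_one y t k₁ h hy0 hy1 hk₁low hHcomp
  have hkey : usage y t j k₁ h * (o * (u * ((h : ℝ) - S) - S * g)) ≤ R := by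
    simp only [usage, gateOf, if_neg hnj]
    rw [div_mul_eq_mul_div, div_le_iff₀ (by linarith)]
    linarith
  -- the sharp exchange certificate with `x_H = o`, `x_G = 0`
  refine gatedSliceMixLaw_BTwin_exchange_sharp y z g S lam a j M h k₁ k₂ xP o 0 hy0 hy1 hz0 hz1 hg0.le hg1' hS0 hhj hhM hSh
    hk hk₂M hlam0 hlam1 hk₁j hk₁low hPj hPmid hk₂G hhaG hhmid hxP0 ho0 le_rfl (by rw [ho]; ring) hPcomp (fun _ => hHcomp) hcapP ?_
  -- divide `hkey` by `h`
  have e1 : usage y t j k₁ h * o * (y / (1 - y) * (1 - S / h) - S / h * g)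
      = usage y t j k₁ h * (o * (u * ((h : ℝ) - S) - S * g)) / h := by
    rw [hu]; field_simp
  have e2 : S / h * (1 - g) * ((1 - z) * lam - y / (1 - y) * z - y / (1 - y) * 0) = R / h := by
    rw [hR, hu]; field_simp; ring
  rw [e1, e2]
  exact div_le_div_of_nonneg_right hkey hh0.le

/-- **`MixLawRegimeB` FROM ITS LAST LEAF.**  With cell B-TWIN a theorem, census-2's `mixLawRegimeB_of_leaves` leaves only
`MixLawCellBTopBelow` (the weak-mid atom below a saturated top) between the lane and regime B of `GatedSliceMixLaw'`. [this work] -/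
theorem mixLawRegimeB_of_topBelow (hTB : MixLawCellBTopBelow) : MixLawRegimeB :=
  mixLawRegimeB_of_leaves hTB mixLawCellBTwin_holds

end LawDec

end Quant

end Summit.CriticalPhenomena.PercolationContinuityZ3.Theorems
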